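import Mathlib
import HarnessLib
import Summits.HubbardSuperconductivity.HubbardSuperconductivity.Theorems.KLProgrammeMatsubaraZeroSound

/-!
# Route `KLProgramme` — crux K3 split, ENGINE child (`KLRegimeEngineV7`, stmt-HubbardSuperconductivity-19662; `stub_engine_step`'s (T)/(E.2)
# clause): the WEIGHTED zero-sound bubble of a radial shell at finite temperature — an `e`-dependent insertion `W(e)` (the level-set
# Jacobian / density of states of the frame band, a slowly varying vertex factor) costs `O(Lip(G)·Lip(W)·r⁷)` in the continuum (first-order
# cancellation) plus the Matsubara Riemann error (cell gate-hubbard-kl, seat hubbard-kl-k3c2-p2 «thermal-bar induction n ≤ nScales β + 1»)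

Continues `…MatsubaraZeroSound` (p456569, `klzd_*`: the FLAT bubble `β⁻¹Σ_ω ∫ G(ω²+e²)(iω+e)² de` is `≤ 8·L·r⁴·(r + 2π/β)/β`, continuum value
`0`).  In the engine's single-slice particle–hole bubble at zero transfer the `(k₀, e)`-integrand is the radial one TIMES the density of states
`J(e)` of the frame band along the level set `e_K = e` (co-area), and possibly a slowly varying insertion; DECOMP App. E Lemma E.2 (ii) STEP 2:
«`𝒥(θ,e) = 𝒥₀(θ) + 𝒥₁(θ)e + O(e²)` … the remainders are bounded sign-blind `≤ C(γ^{2j}‖Φ‖ + γ^j‖∂Φ‖)`».  Here, at first order and with the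
crudest constants: for `W : ℝ → ℂ` continuous with `‖W(e) − W(0)‖ ≤ L_W|e|` and `‖W(e)‖ ≤ B_W` on `|e| < r`,
* `klzw_integral_plane_weighted_norm_le`: `‖∫∫ G(k₀²+e²)(ik₀+e)²·W(e)‖ ≤ 4·L·L_W·r⁷` (`W(0)`-part `= 0` by `klzd_integral_plane_eq_zero`; the
  rest is `≤ |G|·s·L_W|e| ≤ L r²·r²·L_W r` on the box `[−r,r]²`);
* `klzw_freqFn_lipschitz` / `klzw_freqFn_zero`: `g_W(k₀) := ∫ Ψ_G(k₀,e)W(e) de` is `8·L·B_W·r⁴`-Lipschitz and vanishes for `|k₀| ≥ r`;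
* **`klzw_discrete_weighted_bubble_norm_le`**: for `β > 0`, `M ≥ βr/(2π) + 1`,
  `‖β⁻¹ • Σ_{i : MatsubaraIdx M} ∫ G(ω_i²+e²)(iω_i+e)² W(e) de‖ ≤ (2π)⁻¹·4·L·L_W·r⁷ + 8·L·B_W·r⁴·(r + 2π/β)/β`.
SIZES at scale `n`: `r ≍ Λ_n`, `L ≍ Λ_n^{−6}` ⇒ first term `≍ Λ_n·L_W` (E.2 (ii)'s «`O(γ^j)` Jacobian» term, under the geometric part `16·4^{−n}`
of `klEngGeo.phGain n 0`), second term `≍ B_W·(π/β)/Λ_n` (the (T) `thermalBar` profile, `…SplitThermalLayer(V5)`).  The frame dependence of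
`J` is `O(‖D²K‖) = O(Gfr·U²)` (FrameOK), i.e. enters at `O(U⁴Λ_n)` under the cubic `Q`-level remainder.  Pure analysis; nothing about the model
is asserted.  References: BGM 2006 §2.5 (2.56a)–(2.56e); HOME/p1/E2-NOTE.md §3 STEP 2–4; `…TwoPointLimitZeroSound` (p1, `klzs_*`).
-/

noncomputable section

namespace Summit.HubbardSuperconductivity.HubbardSuperconductivity.Theorems.KLRegimeSplit

set_option linter.dupNamespace false -- summit = problem name (single-conjunct summit), D-0017

open Real Finset MeasureTheory Complex Literature.MathematicalPhysics.QuantumLattice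
open Summit.HubbardSuperconductivity.HubbardSuperconductivity.Theorems

section Weighted

variable {G : ℝ → ℂ} {L r : ℝ} {W : ℝ → ℂ} {LW BW : ℝ}

/-! ## §1 Pointwise bounds -/

/-- On the plane, `‖G(k₀²+e²)(ik₀+e)²‖ ≤ L·r⁴`, and the integrand vanishes unless `k₀² + e² < r²`. -/
theorem klzw_norm_integrand_le (hlip : ∀ s s', ‖G s - G s'‖ ≤ L * |s - s'|) (hsupp : ∀ s, r ^ 2 ≤ s → G s = 0) (k₀ e : ℝ) :
    ‖G (k₀ ^ 2 + e ^ 2) * (I * k₀ + e) ^ 2‖ ≤ L * r ^ 4 := by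
  have hL : 0 ≤ L := by
    have := hlip 0 1; have h0 : (0:ℝ) ≤ ‖G 0 - G 1‖ := norm_nonneg _; norm_num at this; linarith
  rcases lt_or_ge (k₀ ^ 2 + e ^ 2) (r ^ 2) with hs | hs
  · rw [norm_mul, klzd_norm_lin_sq]
    have hG : ‖G (k₀ ^ 2 + e ^ 2)‖ ≤ L * r ^ 2 := klzd_norm_G_le hlip hsupp (by positivity)
    calc ‖G (k₀ ^ 2 + e ^ 2)‖ * (k₀ ^ 2 + e ^ 2) ≤ L * r ^ 2 * r ^ 2 := mul_le_mul hG hs.le (by positivity) (by positivity)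
      _ = L * r ^ 4 := by ring
  · rw [hsupp _ hs, zero_mul, norm_zero]; positivity

/-- **The first-order part of the weighted integrand is small**: `‖Ψ_G(k₀,e)·(W(e) − W(0))‖ ≤ L·L_W·r⁵` everywhere (and `= 0` off the disc). -/
theorem klzw_norm_integrand_sub_le (hlip : ∀ s s', ‖G s - G s'‖ ≤ L * |s - s'|) (hsupp : ∀ s, r ^ 2 ≤ s → G s = 0) (hr : 0 < r)
    (hLW : 0 ≤ LW) (hWlip : ∀ e : ℝ, |e| < r → ‖W e - W 0‖ ≤ LW * |e|) (k₀ e : ℝ) :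
    ‖G (k₀ ^ 2 + e ^ 2) * (I * k₀ + e) ^ 2 * (W e - W 0)‖ ≤ L * LW * r ^ 5 := by
  have hL : 0 ≤ L := by
    have := hlip 0 1; have h0 : (0:ℝ) ≤ ‖G 0 - G 1‖ := norm_nonneg _; norm_num at this; linarith
  rcases lt_or_ge (k₀ ^ 2 + e ^ 2) (r ^ 2) with hs | hs
  · have he : |e| < r := by nlinarith [sq_abs e, sq_nonneg k₀, abs_nonneg e]
    rw [norm_mul]
    have h1 := klzw_norm_integrand_le hlip hsupp k₀ e
    have h2 : ‖W e - W 0‖ ≤ LW * r := (hWlip e he).trans (mul_le_mul_of_nonneg_left he.le hLW)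
    calc ‖G (k₀ ^ 2 + e ^ 2) * (I * k₀ + e) ^ 2‖ * ‖W e - W 0‖ ≤ L * r ^ 4 * (LW * r) :=
          mul_le_mul h1 h2 (norm_nonneg _) (by positivity)
      _ = L * LW * r ^ 5 := by ring
  · rw [hsupp _ hs, zero_mul, zero_mul, norm_zero]; positivity

/-- The weighted integrand vanishes off the box `[−r, r]²` (indeed off the disc). -/
theorem klzw_integrand_zero_of_not_mem (hsupp : ∀ s, r ^ 2 ≤ s → G s = 0) (hr : 0 ≤ r) {p : ℝ × ℝ}
    (hp : p ∉ Set.Icc (-r) r ×ˢ Set.Icc (-r) r) (c : ℂ) :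
    G (p.1 ^ 2 + p.2 ^ 2) * (I * p.1 + p.2) ^ 2 * c = 0 := by
  rw [Set.mem_prod, Set.mem_Icc, Set.mem_Icc] at hp
  have : r ≤ |p.1| ∨ r ≤ |p.2| := by
    by_contra h
    push Not at h
    rw [abs_lt, abs_lt] at h
    exact hp ⟨⟨h.1.1.le, h.1.2.le⟩, ⟨h.2.1.le, h.2.2.le⟩⟩
  rcases this with h | h
  · rw [klzd_integrand_zero_of_le_abs_fst hsupp h hr, zero_mul]
  · rw [klzd_integrand_zero_of_le_abs_snd hsupp _ h hr, zero_mul]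

/-! ## §2 The continuum weighted bubble: first-order cancellation -/

/-- The box `[−r, r]²` has Lebesgue measure `(2r)²`. -/
theorem klzw_volume_box (r : ℝ) :
    (volume : Measure (ℝ × ℝ)) (Set.Icc (-r) r ×ˢ Set.Icc (-r) r) = ENNReal.ofReal (2 * r) * ENNReal.ofReal (2 * r) := by
  rw [Measure.volume_eq_prod, Measure.prod_prod, Real.volume_Icc]
  congr 1 <;> congr 1 <;> ring

/-- **First-order cancellation in the continuum**: `‖∫∫ G(k₀²+e²)(ik₀+e)²·W(e)‖ ≤ 4·L·L_W·r⁷`. -/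
theorem klzw_integral_plane_weighted_norm_le (hlip : ∀ s s', ‖G s - G s'‖ ≤ L * |s - s'|) (hsupp : ∀ s, r ^ 2 ≤ s → G s = 0)
    (hr : 0 < r) (hW : Continuous W) (hLW : 0 ≤ LW) (hWlip : ∀ e : ℝ, |e| < r → ‖W e - W 0‖ ≤ LW * |e|) :
    ‖∫ p : ℝ × ℝ, G (p.1 ^ 2 + p.2 ^ 2) * (I * p.1 + p.2) ^ 2 * W p.2‖ ≤ 4 * L * LW * r ^ 7 := by
  have hL : 0 ≤ L := by
    have := hlip 0 1; have h0 : (0:ℝ) ≤ ‖G 0 - G 1‖ := norm_nonneg _; norm_num at this; linarith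
  -- integrability of the three integrands (continuous, supported in the closed ball of radius r)
  have hΨ : Continuous fun p : ℝ × ℝ => G (p.1 ^ 2 + p.2 ^ 2) * (I * p.1 + p.2) ^ 2 := klzd_continuous hlip
  have hsuppK : ∀ (c : ℝ × ℝ → ℂ), HasCompactSupport fun p : ℝ × ℝ => G (p.1 ^ 2 + p.2 ^ 2) * (I * p.1 + p.2) ^ 2 * c p := by
    intro c
    refine HasCompactSupport.intro ((isCompact_Icc (a := -r) (b := r)).prod (isCompact_Icc (a := -r) (b := r))) fun p hp => ?_
    exact klzw_integrand_zero_of_not_mem hsupp hr.le hp (c p)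
  have hI1 : Integrable fun p : ℝ × ℝ => G (p.1 ^ 2 + p.2 ^ 2) * (I * p.1 + p.2) ^ 2 * (W p.2 - W 0) :=
    (hΨ.mul ((hW.comp continuous_snd).sub continuous_const)).integrable_of_hasCompactSupport (hsuppK fun p => W p.2 - W 0)
  have hI2 : Integrable fun p : ℝ × ℝ => G (p.1 ^ 2 + p.2 ^ 2) * (I * p.1 + p.2) ^ 2 * W 0 :=
    (hΨ.mul continuous_const).integrable_of_hasCompactSupport (hsuppK fun _ => W 0)
  -- split `W = (W − W 0) + W 0`
  have hsplit : (fun p : ℝ × ℝ => G (p.1 ^ 2 + p.2 ^ 2) * (I * p.1 + p.2) ^ 2 * W p.2) =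
      fun p => G (p.1 ^ 2 + p.2 ^ 2) * (I * p.1 + p.2) ^ 2 * (W p.2 - W 0) + G (p.1 ^ 2 + p.2 ^ 2) * (I * p.1 + p.2) ^ 2 * W 0 := by
    funext p; ring
  rw [hsplit, integral_add hI1 hI2, integral_mul_const, klzd_integral_plane_eq_zero G, zero_mul, add_zero]
  -- the first-order part: pointwise ≤ indicator of the box × `L·L_W·r⁵`
  set c : ℝ := L * LW * r ^ 5 with hc
  have hbound : ∀ p : ℝ × ℝ, ‖G (p.1 ^ 2 + p.2 ^ 2) * (I * p.1 + p.2) ^ 2 * (W p.2 - W 0)‖ ≤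
      Set.indicator (Set.Icc (-r) r ×ˢ Set.Icc (-r) r) (fun _ => c) p := by
    intro p
    by_cases hp : p ∈ Set.Icc (-r) r ×ˢ Set.Icc (-r) r
    · rw [Set.indicator_of_mem hp]
      exact klzw_norm_integrand_sub_le hlip hsupp hr hLW hWlip p.1 p.2
    · rw [Set.indicator_of_notMem hp, klzw_integrand_zero_of_not_mem hsupp hr.le hp, norm_zero]
  have hmeas : MeasurableSet (Set.Icc (-r) r ×ˢ Set.Icc (-r) r : Set (ℝ × ℝ)) := measurableSet_Icc.prod measurableSet_Icc
  have hfin : (volume : Measure (ℝ × ℝ)) (Set.Icc (-r) r ×ˢ Set.Icc (-r) r) ≠ ⊤ := by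
    rw [klzw_volume_box r]; exact ENNReal.mul_ne_top ENNReal.ofReal_ne_top ENNReal.ofReal_ne_top
  have hind : Integrable (Set.indicator (Set.Icc (-r) r ×ˢ Set.Icc (-r) r) (fun _ : ℝ × ℝ => c)) :=
    IntegrableOn.integrable_indicator (integrableOn_const hfin) hmeas
  calc ‖∫ p : ℝ × ℝ, G (p.1 ^ 2 + p.2 ^ 2) * (I * p.1 + p.2) ^ 2 * (W p.2 - W 0)‖
      ≤ ∫ p : ℝ × ℝ, Set.indicator (Set.Icc (-r) r ×ˢ Set.Icc (-r) r) (fun _ => c) p :=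
        norm_integral_le_of_norm_le hind (Filter.Eventually.of_forall hbound)
    _ = ((volume : Measure (ℝ × ℝ)) (Set.Icc (-r) r ×ˢ Set.Icc (-r) r)).toReal * c := by
        rw [integral_indicator_const _ hmeas, smul_eq_mul, Measure.real]
    _ = (2 * r) * (2 * r) * c := by
        rw [klzw_volume_box r, ENNReal.toReal_mul, ENNReal.toReal_ofReal (by linarith)]
    _ = 4 * L * LW * r ^ 7 := by rw [hc]; ring

/-! ## §3 The weighted frequency function `g_W(k₀) = ∫ Ψ_G(k₀,e) W(e) de` -/

/-- Each frequency slice of the weighted integrand is integrable in `e`. -/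
theorem klzw_integrable_slice (hlip : ∀ s s', ‖G s - G s'‖ ≤ L * |s - s'|) (hsupp : ∀ s, r ^ 2 ≤ s → G s = 0) (hr : 0 ≤ r)
    (hW : Continuous W) (k : ℝ) : Integrable fun e : ℝ => G (k ^ 2 + e ^ 2) * (I * k + e) ^ 2 * W e := by
  have hc : Continuous fun e : ℝ => G (k ^ 2 + e ^ 2) * (I * k + e) ^ 2 * W e :=
    ((klzd_continuous hlip).comp (Continuous.prodMk continuous_const continuous_id)).mul hW
  refine hc.integrable_of_hasCompactSupport ?_
  refine HasCompactSupport.intro (isCompact_Icc (a := -r) (b := r)) fun e he => ?_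
  rw [Set.mem_Icc, not_and_or, not_le, not_le] at he
  have : r ≤ |e| := by
    rcases he with h | h
    · exact le_trans (by linarith) (neg_le_abs e)
    · exact le_trans h.le (le_abs_self e)
  rw [klzd_integrand_zero_of_le_abs_snd hsupp k this hr, zero_mul]

/-- `g_W(k₀) = 0` for `|k₀| ≥ r`. -/
theorem klzw_freqFn_zero (hsupp : ∀ s, r ^ 2 ≤ s → G s = 0) (hr : 0 ≤ r) {k₀ : ℝ} (hk : r ≤ |k₀|) :
    ∫ e : ℝ, G (k₀ ^ 2 + e ^ 2) * (I * k₀ + e) ^ 2 * W e = 0 := by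
  simp_rw [klzd_integrand_zero_of_le_abs_fst hsupp hk hr, zero_mul]
  exact integral_zero _ _

/-- **`g_W` is `8·L·B_W·r⁴`-Lipschitz** (`‖W‖ ≤ B_W` on `|e| < r`). -/
theorem klzw_freqFn_lipschitz (hlip : ∀ s s', ‖G s - G s'‖ ≤ L * |s - s'|) (hsupp : ∀ s, r ^ 2 ≤ s → G s = 0) (hr : 0 < r)
    (hW : Continuous W) (hBW : 0 ≤ BW) (hWbd : ∀ e : ℝ, |e| < r → ‖W e‖ ≤ BW) (k₀ k₀' : ℝ) :
    ‖(∫ e : ℝ, G (k₀ ^ 2 + e ^ 2) * (I * k₀ + e) ^ 2 * W e) - ∫ e : ℝ, G (k₀' ^ 2 + e ^ 2) * (I * k₀' + e) ^ 2 * W e‖ ≤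
      8 * L * BW * r ^ 4 * |k₀ - k₀'| := by
  have hL : 0 ≤ L := by
    have := hlip 0 1; have h0 : (0:ℝ) ≤ ‖G 0 - G 1‖ := norm_nonneg _; norm_num at this; linarith
  rw [← integral_sub (klzw_integrable_slice hlip hsupp hr.le hW k₀) (klzw_integrable_slice hlip hsupp hr.le hW k₀')]
  set c : ℝ := 4 * L * r ^ 3 * |k₀ - k₀'| * BW with hc
  have hbound : ∀ e : ℝ,
      ‖G (k₀ ^ 2 + e ^ 2) * (I * k₀ + e) ^ 2 * W e - G (k₀' ^ 2 + e ^ 2) * (I * k₀' + e) ^ 2 * W e‖ ≤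
        Set.indicator (Set.Icc (-r) r) (fun _ => c) e := by
    intro e
    rw [← sub_mul]
    by_cases he : e ∈ Set.Icc (-r) r
    · rw [Set.indicator_of_mem he, norm_mul]
      rcases lt_or_ge (|e|) r with hlt | hge
      · exact mul_le_mul (klzd_lipschitz_fst hlip hsupp hr e k₀ k₀') (hWbd e hlt) (norm_nonneg _) (by positivity)
      · rw [klzd_integrand_zero_of_le_abs_snd hsupp k₀ hge hr.le, klzd_integrand_zero_of_le_abs_snd hsupp k₀' hge hr.le, sub_zero,
          norm_zero, zero_mul]
        positivity
    · rw [Set.indicator_of_notMem he]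
      rw [Set.mem_Icc, not_and_or, not_le, not_le] at he
      have : r ≤ |e| := by
        rcases he with h | h
        · exact le_trans (by linarith) (neg_le_abs e)
        · exact le_trans h.le (le_abs_self e)
      rw [klzd_integrand_zero_of_le_abs_snd hsupp k₀ this hr.le, klzd_integrand_zero_of_le_abs_snd hsupp k₀' this hr.le, sub_zero,
        zero_mul, norm_zero]
  have hind : Integrable (Set.indicator (Set.Icc (-r) r) (fun _ : ℝ => c)) := by
    refine IntegrableOn.integrable_indicator ?_ measurableSet_Icc
    exact integrableOn_const (by rw [Real.volume_Icc]; exact ENNReal.ofReal_ne_top)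
  calc ‖∫ e : ℝ, (G (k₀ ^ 2 + e ^ 2) * (I * k₀ + e) ^ 2 * W e - G (k₀' ^ 2 + e ^ 2) * (I * k₀' + e) ^ 2 * W e)‖
      ≤ ∫ e : ℝ, Set.indicator (Set.Icc (-r) r) (fun _ => c) e := norm_integral_le_of_norm_le hind (Filter.Eventually.of_forall hbound)
    _ = (volume (Set.Icc (-r) r)).toReal * c := by rw [integral_indicator_const _ measurableSet_Icc, smul_eq_mul, Measure.real]
    _ = 2 * r * c := by rw [Real.volume_Icc, ENNReal.toReal_ofReal (by linarith)]; ring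
    _ = 8 * L * BW * r ^ 4 * |k₀ - k₀'| := by rw [hc]; ring

/-- **`∫ g_W = ∫∫ Ψ_G·W`** (Fubini). -/
theorem klzw_integral_freqFn_eq (hlip : ∀ s s', ‖G s - G s'‖ ≤ L * |s - s'|) (hsupp : ∀ s, r ^ 2 ≤ s → G s = 0) (hr : 0 ≤ r)
    (hW : Continuous W) :
    ∫ k₀ : ℝ, ∫ e : ℝ, G (k₀ ^ 2 + e ^ 2) * (I * k₀ + e) ^ 2 * W e =
      ∫ p : ℝ × ℝ, G (p.1 ^ 2 + p.2 ^ 2) * (I * p.1 + p.2) ^ 2 * W p.2 := by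
  have hI : Integrable fun p : ℝ × ℝ => G (p.1 ^ 2 + p.2 ^ 2) * (I * p.1 + p.2) ^ 2 * W p.2 := by
    refine ((klzd_continuous hlip).mul (hW.comp continuous_snd)).integrable_of_hasCompactSupport ?_
    refine HasCompactSupport.intro ((isCompact_Icc (a := -r) (b := r)).prod (isCompact_Icc (a := -r) (b := r))) fun p hp => ?_
    exact klzw_integrand_zero_of_not_mem hsupp hr hp (W p.2)
  have h := integral_prod (μ := (volume : Measure ℝ)) (ν := (volume : Measure ℝ))
    (f := fun p : ℝ × ℝ => G (p.1 ^ 2 + p.2 ^ 2) * (I * p.1 + p.2) ^ 2 * W p.2) (by rwa [← Measure.volume_eq_prod])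
  simp only at h
  rw [← h, ← Measure.volume_eq_prod]

/-! ## §4 The discrete weighted bubble -/

/-- **The weighted zero-sound bubble of a radial weight at finite temperature.**  For `G : ℝ → ℂ` `L`-Lipschitz with `G(s) = 0` for
`s ≥ r²` (`r > 0`), a continuous insertion `W : ℝ → ℂ` with `‖W(e) − W(0)‖ ≤ L_W|e|` and `‖W(e)‖ ≤ B_W` on `|e| < r`, `β > 0` and every
Matsubara cutoff `M ≥ βr/(2π) + 1`:
`‖β⁻¹ • Σ_{i : MatsubaraIdx M} ∫ G(ω_i² + e²)(iω_i + e)² W(e) de‖ ≤ (2π)⁻¹·4·L·L_W·r⁷ + 8·L·B_W·r⁴·(r + 2π/β)/β` —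
the «`O(Λ_n)` Jacobian» term of E.2 (ii) plus the (T) Riemann term. -/
theorem klzw_discrete_weighted_bubble_norm_le (hlip : ∀ s s', ‖G s - G s'‖ ≤ L * |s - s'|)
    (hsupp : ∀ s, r ^ 2 ≤ s → G s = 0) (hr : 0 < r) (hW : Continuous W) (hLW : 0 ≤ LW) (hBW : 0 ≤ BW)
    (hWlip : ∀ e : ℝ, |e| < r → ‖W e - W 0‖ ≤ LW * |e|) (hWbd : ∀ e : ℝ, |e| < r → ‖W e‖ ≤ BW)
    {β : ℝ} (hβ : 0 < β) {M : ℕ} (hM : β * r / (2 * Real.pi) + 1 ≤ M) :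
    ‖β⁻¹ • ∑ i : MatsubaraIdx M,
        ∫ e : ℝ, G (matsubaraFreq β M i ^ 2 + e ^ 2) * (I * (matsubaraFreq β M i) + e) ^ 2 * W e‖ ≤
      (2 * Real.pi)⁻¹ * (4 * L * LW * r ^ 7) + 8 * L * BW * r ^ 4 * (r + 2 * Real.pi / β) / β := by
  have hL : 0 ≤ L := by
    have := hlip 0 1; have h0 : (0:ℝ) ≤ ‖G 0 - G 1‖ := norm_nonneg _; norm_num at this; linarith
  set g : ℝ → ℂ := fun k₀ => ∫ e : ℝ, G (k₀ ^ 2 + e ^ 2) * (I * k₀ + e) ^ 2 * W e with hg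
  have hD : 0 ≤ 8 * L * BW * r ^ 4 := by positivity
  have hglip : ∀ t t', ‖g t - g t'‖ ≤ 8 * L * BW * r ^ 4 * |t - t'| := fun t t' =>
    klzw_freqFn_lipschitz hlip hsupp hr hW hBW hWbd t t'
  have hgsupp : ∀ t, r ≤ |t| → g t = 0 := fun t ht => klzw_freqFn_zero hsupp hr.le ht
  have h1 := klmr_matsubara_sum_sub_integral_norm_le hD hglip hr.le hgsupp hβ hM
  have h2 : ‖(2 * Real.pi)⁻¹ • ∫ t, g t‖ ≤ (2 * Real.pi)⁻¹ * (4 * L * LW * r ^ 7) := by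
    rw [norm_smul, Real.norm_of_nonneg (by positivity), hg, klzw_integral_freqFn_eq hlip hsupp hr.le hW]
    exact mul_le_mul_of_nonneg_left (klzw_integral_plane_weighted_norm_le hlip hsupp hr hW hLW hWlip) (by positivity)
  calc ‖β⁻¹ • ∑ i : MatsubaraIdx M, g (matsubaraFreq β M i)‖
      = ‖(β⁻¹ • ∑ i : MatsubaraIdx M, g (matsubaraFreq β M i) - (2 * Real.pi)⁻¹ • ∫ t, g t) + (2 * Real.pi)⁻¹ • ∫ t, g t‖ := by
        rw [sub_add_cancel]
    _ ≤ ‖β⁻¹ • ∑ i : MatsubaraIdx M, g (matsubaraFreq β M i) - (2 * Real.pi)⁻¹ • ∫ t, g t‖ + ‖(2 * Real.pi)⁻¹ • ∫ t, g t‖ :=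
        norm_add_le _ _
    _ ≤ 8 * L * BW * r ^ 4 * (r + 2 * Real.pi / β) / β + (2 * Real.pi)⁻¹ * (4 * L * LW * r ^ 7) := add_le_add h1 h2
    _ = (2 * Real.pi)⁻¹ * (4 * L * LW * r ^ 7) + 8 * L * BW * r ^ 4 * (r + 2 * Real.pi / β) / β := by ring

end Weighted

end Summit.HubbardSuperconductivity.HubbardSuperconductivity.Theorems.KLRegimeSplit

end
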